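import Mathlib
import Summits.NavierStokesRegularity.NavierStokesRegularity.Theorems.EulerZoomLiouvillePowerGaugeEulerLiouvilleHoopRunBareDefs
import Summits.NavierStokesRegularity.NavierStokesRegularity.Theorems.EulerZoomLiouvillePowerGaugeEulerLiouvilleHoopRidgeRunEnergyCoreUniform
import Summits.NavierStokesRegularity.NavierStokesRegularity.Theorems.EulerZoomLiouvillePowerGaugeEulerLiouvilleHoopCapCost
import Summits.NavierStokesRegularity.NavierStokesRegularity.Theorems.EulerZoomLiouvillePowerGaugeEulerLiouvilleHoopLateral
import Summits.NavierStokesRegularity.NavierStokesRegularity.Theorems.EulerZoomLiouvillePowerGaugeEulerLiouvilleHoopRunFreeContradiction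
import Summits.NavierStokesRegularity.NavierStokesRegularity.Theorems.EulerZoomLiouvillePowerGaugeEulerLiouvilleEnergyTail
import Summits.NavierStokesRegularity.NavierStokesRegularity.Theorems.EulerZoomLiouvillePowerGaugeEulerLiouvilleLastExitCriticalSpikes
import HarnessLib

/-!
# Hoop line — K-TJ‴ MEMBERS (alt 8″ and the pressure-ridge form): `StraightRidgeRunsMember` and `StraightSlowHighRunsBareMember`

Sub-problem `NavierStokesRegularity`, crux `PowerGaugeEulerLiouville` (stmt-NavierStokesRegularity-19832; a crux CLASS of self-similar Euler/NS
strata on the MODEL lattice — not NS regularity, not E).  Seat ns-ezl-w3 g7 (nsreg-p2 g41 ROUND-51 «THE CAPS COME FOR FREE» §2,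
`r51/TJbare_Q.lean` 8d19af1dedef3daf: member signatures `StraightRidgeRunsMember` (l.121) / `StraightSlowHighRunsBareMember` (l.103) with
EXACTLY their binder lists; faces `HasStraightRidgeRuns ρ V` / `HasStraightSlowHighRunsBare ρ V` BY NAME (`…HoopRunBareDefs`)).

* `ridgeRunEnergy_conj` — the ridge-run energy law in the form the member consumes: wall radius `T₀ ≤ 1` (a wall `T₀ = βb` with `β > 1`
  is allowed by the face), conclusion on the CONJUGATED field `A⁻¹∘V∘g` (`∫_Z |D(A⁻¹∘V∘g)|_F² ≥ ε₀R²(s₂ − s₁)`), `ρ > −1`: the uniform CORE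
  `HoopCore.ridgeRunEnergyCore_uniform` (ns-sfl-p1 g8; `ε₀, R₁` from `γ, Λ, μ, ν` alone) at the conjugated profile
  `(γ, A⁻¹(−a), A⁻¹∘V∘g, P'∘g)` (`HoopCore.isSelfSimilarEulerProfile_rigid`, t51-PIC) fed with `HoopCore.capCostBound` (t54-CC) and
  `HoopCore.lateralHoopInequality` (t53-LEL, LEAD g15); the by-name law `HoopCore.ridgeRunEnergyLaw` (`…HoopRidgeRunEnergyLaw`, sfl-p1) is the
  `T₀ ≤ b` case rewritten on `V∘g`;
* `Loc.selfSimilar_ae_eq_zero_of_straightRidgeRunsC2_profile` — **the ridge member**: classical pressure (K-SPIKE), finite weighted energy (E)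
  (`NeedleThinCore.selfSimilar_needle_inputs`), the law at aspect `Λ/β`, the E-TAIL `Condenser.energyTail` at `ε₀Λ/6`, ONE run beyond
  `max(R₁, R₂, β)`: `ε₀ΛR^{1−ρ} ≤ ε₀R²·length ≤ ∫_Z|D(A⁻¹∘V∘g)|_F² ≤ ∫_{R≤‖y‖≤2R}|DV|_F² ≤ ½ε₀ΛR^{1−ρ}` — absurd;
* `hasStraightRidgeRuns_of_bare` — alt 8″ ⇒ ridge, run by run, `μ = ½γ(1−γ) − ½λ² − η` (pure real arithmetic from the slow, Bernoulli-high,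
  wall-pressure and shell clauses; `selfSimilarBernoulli_apply`);
* `Loc.selfSimilar_ae_eq_zero_of_straightSlowHighRunsBareC2_profile` — **the alt 8″ member** (LEAD wires `IsKinematicTameProfile` alternative 10).

WHAT THIS IS NOT: not NS, not E — kills the «straight slow∧high (resp. pressure-ridge) run of length ≥ Λb inside a quiet wall of radius βb»
stratum of the MODEL-lattice crux class and nothing else (nothing about BLOBS of aspect ≤ Λ, spines, spikes, tangles); 19832 OPEN;
NS regularity NOT proved.  [nsreg-p2 g41 ROUND-51 §2; ns-idea-11 HOOP-NOTE §10]
-/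

noncomputable section

open MeasureTheory Set Metric Real Function
open scoped InnerProductSpace RealInnerProductSpace Interval ENNReal NNReal

set_option linter.dupNamespace false

namespace Summit.NavierStokesRegularity.NavierStokesRegularity.Theorems.PowerGaugeEulerLiouville

open Literature.Analysis Literature.Analysis.FluidPDE

/-! ## §1 The energy law in conjugated form, wall radius `T₀ ≤ 1` -/

/-- **RIDGE-RUN ENERGY LAW, conjugated form, wall radius `T₀ ≤ 1`** (`ρ > −1`, `γ = 1/(2+ρ)`): for a profile pair `(V, P')` about `0` and
`Λ, μ, ν` with `8ν² + 14γν < Λμ` there are `ε₀ > 0`, `R₁` such that every straight run `x ↦ Ax + a` of `solidCyl s₁ s₂ T₀` in the shell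
`R ≤ ‖y‖ ≤ 2R` (`R ≥ R₁`, `R ≥ 1`, `0 < T₀ ≤ 1`, `s₂ − s₁ ≥ ΛT₀`) with pressure ridge `≥ μR²` and wall speed `≤ νR` has
`∫_Z |D(A⁻¹∘V∘g)|_F² ≥ ε₀R²(s₂ − s₁)`. [nsreg-p2 g41 ROUND-51 §2 (t54-LAW-CORE uniform + t54-CC + t53-LEL + t51-PIC)] -/
theorem ridgeRunEnergy_conj {ρ : ℝ} (hρ : -1 < ρ) (V : EuclideanSpace ℝ (Fin 3) → EuclideanSpace ℝ (Fin 3)) :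
    ∀ P' : EuclideanSpace ℝ (Fin 3) → ℝ, IsSelfSimilarEulerProfile (1 / (2 + ρ)) 0 V P' →
      ∀ Λ μ ν : ℝ, 0 < Λ → 0 < μ → 0 ≤ ν → 8 * ν ^ 2 + 14 * (1 / (2 + ρ)) * ν < Λ * μ →
        ∃ ε₀ : ℝ, 0 < ε₀ ∧ ∃ R₁ : ℝ,
          ∀ (A : EuclideanSpace ℝ (Fin 3) ≃ₗᵢ[ℝ] EuclideanSpace ℝ (Fin 3)) (a : EuclideanSpace ℝ (Fin 3)) (R s₁ s₂ T₀ : ℝ),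
            R₁ ≤ R → 1 ≤ R → 0 < T₀ → T₀ ≤ 1 → s₁ + Λ * T₀ ≤ s₂ →
            (∀ x ∈ HoopCore.solidCyl s₁ s₂ T₀, R ≤ ‖A x + a‖ ∧ ‖A x + a‖ ≤ 2 * R) →
            (∀ σ ∈ Icc s₁ s₂,
                μ * R ^ 2 ≤ P' (A (σ • eZ) + a) - HoopCore.circleAvg (fun x => P' (A x + a)) σ T₀ ∧
                ∀ θ : ℝ, ‖V (A (HoopCore.axisPt σ T₀ θ) + a)‖ ≤ ν * R) →
              ε₀ * R ^ 2 * (s₂ - s₁) ≤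
                ∫ x in HoopCore.solidCyl s₁ s₂ T₀, frobeniusNormSq (fderiv ℝ (fun y => A.symm (V (A y + a))) x) := by
  intro P' hP Λ μ ν hΛ hμ hν hc
  have h2ρ : 0 < 2 + ρ := by linarith
  have hγ0 : 0 < 1 / (2 + ρ) := by positivity
  have hγ1 : 1 / (2 + ρ) < 1 := by rw [div_lt_one h2ρ]; linarith
  obtain ⟨ε₀, hε₀, R₁, hcore⟩ := HoopCore.ridgeRunEnergyCore_uniform (1 / (2 + ρ)) Λ μ ν hγ0 hγ1 hΛ hμ hν hc
  refine ⟨ε₀, hε₀, R₁, fun A a R s₁ s₂ T₀ hR₁ hR1 hT₀ hT₀1 hlen hshell hcl => ?_⟩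
  -- the conjugated profile `V' = A⁻¹ ∘ V ∘ g`, centre `c' = A⁻¹(−a)`, pressure `P' ∘ g`
  have hP' := HoopCore.isSelfSimilarEulerProfile_rigid hP A a
  have hV'1 : ContDiff ℝ 1 (fun y => A.symm (V (A y + a))) := hP'.contDiff_velocity.of_le (by norm_num)
  -- geometry of the centre: the axis segment lies in the run
  have hs : s₁ ≤ s₂ := by nlinarith [mul_pos hΛ hT₀]
  have hcen : ∀ σ ∈ Icc s₁ s₂, ‖σ • eZ - A.symm (-a)‖ ≤ 2 * R := fun σ hσ => by
    rw [HoopCore.norm_sub_centre_rigid]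
    exact (hshell (σ • eZ) (HoopCore.smul_eZ_mem_solidCyl hσ hT₀.le)).2
  have hc2 : ∀ σ ∈ Icc s₁ s₂, |σ - (A.symm (-a)) 2| ≤ 2 * R := fun σ hσ => by
    have h1 : |(σ • eZ - A.symm (-a)) 2| ≤ ‖σ • eZ - A.symm (-a)‖ := by
      simpa only [Real.norm_eq_abs] using PiLp.norm_apply_le (σ • eZ - A.symm (-a)) 2
    have h2 : (σ • eZ - A.symm (-a)) 2 = σ - (A.symm (-a)) 2 := by
      simp [eZ]
    rw [← h2]
    exact h1.trans (hcen σ hσ)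
  have hcyl : cylRadius (A.symm (-a)) ≤ 2 * R := by
    have hσ : s₁ ∈ Icc s₁ s₂ := ⟨le_rfl, hs⟩
    have h1 : cylRadius (A.symm (-a)) = cylRadius (A.symm (-a) - s₁ • eZ) := by
      simp [cylRadius, eZ]
    have h2 : cylRadius (A.symm (-a) - s₁ • eZ) ≤ ‖A.symm (-a) - s₁ • eZ‖ := by
      rw [cylRadius, EuclideanSpace.norm_eq]
      refine Real.sqrt_le_sqrt ?_
      rw [Fin.sum_univ_three]
      simp only [Real.norm_eq_abs, sq_abs]
      nlinarith [sq_nonneg ((A.symm (-a) - s₁ • eZ) 2)]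
    rw [h1]
    exact h2.trans (by rw [norm_sub_rev]; exact hcen s₁ hσ)
  -- the cap cost bound (t54-CC) and the lateral hoop inequality (t53-LEL) of the conjugated profile feed the uniform CORE
  have hCC : ∀ σ T w : ℝ, 0 < T → 0 ≤ w →
      (∀ θ : ℝ, ‖(fun y => A.symm (V (A y + a))) (HoopCore.axisPt σ T θ)‖ ≤ w) → _ :=
    fun σ T w hT hw hwall => HoopCore.capCostBound (1 / (2 + ρ)) (A.symm (-a)) (fun y => A.symm (V (A y + a))) σ T w hT hw hV'1 hwall
  exact hcore (A.symm (-a)) (fun y => A.symm (V (A y + a))) (fun y => P' (A y + a)) hP'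
    (fun σ T w hT hw hwall => by
      have h := hCC σ T w hT hw hwall
      simp only [HoopCore.discEnergy, HoopCore.discMass] at h
      exact h)
    R s₁ s₂ T₀ hR₁ hR1 hT₀ hT₀1 hlen hcyl hc2
    (fun σ₁ σ₂ _ h12 _ => HoopCore.lateralHoopInequality _ σ₁ σ₂ T₀ h12 hT₀ hV'1 hP'.divFree)
    (fun σ hσ => ⟨(hcl σ hσ).1, fun θ => by rw [LinearIsometryEquiv.norm_map]; exact (hcl σ hσ).2 θ⟩)

/-! ## §2 The pressure-ridge member -/

/-- **K-TJ‴ MEMBER (pressure-ridge form)**: in the power-gauge class at `0 < ρ ≤ ½`, the collapse profile of a backward self-similar class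
member whose profile `V` is `C²` and carries STRAIGHT PRESSURE-RIDGE RUNS cofinally (`HasStraightRidgeRuns ρ V`) is trivial: `u = 0` a.e.
Binders: exactly `StraightRidgeRunsMember` (`r51/TJbare_Q.lean` l.121), face BY NAME.  Proof: classical pressure, the finite weighted energy (E),
the ridge-run energy law at aspect `Λ/β`, the E-TAIL at `ε₀Λ/6`, one run — `ε₀ΛR^{1−ρ} ≤ ε₀R²(s₂−s₁) ≤ ∫_Z|D(A⁻¹∘V∘g)|_F² ≤ ½ε₀ΛR^{1−ρ}`.
[nsreg-p2 g41 ROUND-51 §2; ns-idea-11 HOOP-NOTE §10] -/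
theorem Loc.selfSimilar_ae_eq_zero_of_straightRidgeRunsC2_profile {ρ : ℝ} (hρ : 0 < ρ) (hρ1 : ρ ≤ 1 / 2)
    {u : ℝ → EuclideanSpace ℝ (Fin 3) → EuclideanSpace ℝ (Fin 3)} {p : ℝ → EuclideanSpace ℝ (Fin 3) → ℝ}
    {H : ℝ → EuclideanSpace ℝ (Fin 3) → EuclideanSpace ℝ (Fin 3) →L[ℝ] EuclideanSpace ℝ (Fin 3)} {c : ℝ≥0}
    (hsw : IsSuitableWeakSolutionOn (slab (EuclideanSpace ℝ (Fin 3)) (Iio 0) isOpen_Iio) 0 0 u p)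
    (hH : HasWeakSpatialGradientOn (slab (EuclideanSpace ℝ (Fin 3)) (Iio 0) isOpen_Iio) u H)
    (hgauge : ∀ a : ℝ, 0 < a →
      ENNReal.ofReal (a ^ (2 * ρ)) * cknA a (0 : ℝ × EuclideanSpace ℝ (Fin 3)) u +
          ENNReal.ofReal (a ^ ρ) * cknE a (0 : ℝ × EuclideanSpace ℝ (Fin 3)) H +
        ENNReal.ofReal (a ^ (2 * ρ)) * cknD a (0 : ℝ × EuclideanSpace ℝ (Fin 3)) p ≤ (c : ℝ≥0∞))
    {V : EuclideanSpace ℝ (Fin 3) → EuclideanSpace ℝ (Fin 3)} {P : EuclideanSpace ℝ (Fin 3) → ℝ}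
    (hu : ∀ τ : ℝ, τ < 0 → u τ = selfSimilarCollapse (1 / (2 + ρ)) 0 V τ)
    (hp : ∀ τ : ℝ, τ < 0 → p τ = selfSimilarCollapsePressure (1 / (2 + ρ)) 0 P τ)
    (hV : ContDiff ℝ 2 V)
    (hQ : HasStraightRidgeRuns ρ V) :
    uncurry u =ᵐ[volume.restrict (Iio (0 : ℝ) ×ˢ (univ : Set (EuclideanSpace ℝ (Fin 3))))] 0 := by
  have hρ1' : ρ < 1 := by linarith
  -- ### a classical pressure for the profile (as in K-SPIKE)
  have hD : ∀ a : ℝ, 0 < a → ENNReal.ofReal (a ^ (2 * ρ)) *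
      cknD a (0 : ℝ × EuclideanSpace ℝ (Fin 3)) p ≤ (c : ℝ≥0∞) :=
    fun a ha => le_trans le_add_self (hgauge a ha)
  have hpm : AEStronglyMeasurable (uncurry p)
      (volume.restrict (Iio (0 : ℝ) ×ˢ (univ : Set (EuclideanSpace ℝ (Fin 3))))) := by
    have := hsw.distributional.2.2.1.aestronglyMeasurable
    simpa [slab] using this
  have hPm := aestronglyMeasurable_pressureProfile hpm hp
  have hDprof := profile_pressure_weight_of_gaugeD hρ hρ1' hpm hp hD
  have hP1 : LocallyIntegrable P volume :=
    EnergySaturation.locallyIntegrable_pressure_of_weight hρ1' hPm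
      (ENNReal.mul_ne_top ENNReal.ofReal_ne_top ENNReal.coe_ne_top) hDprof
  obtain ⟨P', hprof⟩ :=
    WeakToClassical.exists_isSelfSimilarEulerProfile_of_contDiff hsw.distributional hu hp hV hP1
  have hV1 : ContDiff ℝ 1 V := hV.of_le one_le_two
  -- ### the finite weighted energy of the class (E)
  obtain ⟨-, hE'⟩ :=
    NeedleThinCore.selfSimilar_needle_inputs hρ hρ1' hsw hH hgauge hu hp hV1
  have hEfin : (∫⁻ y, ‖fderiv ℝ V y‖ₑ ^ 2 * ENNReal.ofReal (‖y‖ ^ (ρ - 1))) ≠ ⊤ :=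
    ne_top_of_le_ne_top ENNReal.ofReal_ne_top hE'
  -- ### the face, the law at aspect `Λ/β`, the tail at `ε₀Λ/6`, one run
  obtain ⟨Λ, β, μ, ν, hΛ, hβ, hμ, hν, hc, hrun⟩ := hQ P' hprof
  have hc' : 8 * ν ^ 2 + 14 * (1 / (2 + ρ)) * ν < Λ / β * μ := by
    rw [div_mul_eq_mul_div, lt_div_iff₀ hβ]
    linarith
  obtain ⟨ε₀, hε₀, R₁, hlaw⟩ := ridgeRunEnergy_conj (by linarith) V P' hprof (Λ / β) μ ν (by positivity) hμ hν hc'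
  obtain ⟨R₂, hR₂⟩ := Condenser.energyTail ρ hρ1' V hV1 hEfin (ε₀ * Λ / 6) (by positivity)
  obtain ⟨A, a, R, s₁, s₂, hR₀R, hR1, hlen, hshell, hcl⟩ := hrun (max (max R₁ R₂) β)
  have hR0 : 0 < R := by linarith
  have hRR₁ : R₁ ≤ R := le_trans (le_trans (le_max_left _ _) (le_max_left _ _)) hR₀R
  have hRR₂ : R₂ ≤ R := le_trans (le_trans (le_max_right _ _) (le_max_left _ _)) hR₀R
  have hRβ : β ≤ R := le_trans (le_max_right _ _) hR₀R
  -- `b = R^{−(1+ρ)}`, the wall radius `βb ≤ 1`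
  set b : ℝ := R ^ (-(1 + ρ)) with hbdef
  have hb : 0 < b := Real.rpow_pos_of_pos hR0 _
  have hbR : b ≤ 1 / R := by
    have h1 : R ^ (-(1 + ρ)) ≤ R ^ (-(1 : ℝ)) := Real.rpow_le_rpow_of_exponent_le hR1 (by linarith)
    have h2 : R ^ (-(1 : ℝ)) = 1 / R := by rw [Real.rpow_neg hR0.le, Real.rpow_one, one_div]
    exact h1.trans h2.le
  have hT₀ : 0 < β * b := mul_pos hβ hb
  have hT₀1 : β * b ≤ 1 := by
    calc β * b ≤ β * (1 / R) := mul_le_mul_of_nonneg_left hbR hβ.le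
      _ ≤ 1 := by rw [mul_one_div, div_le_one hR0]; exact hRβ
  have hlen' : s₁ + Λ / β * (β * b) ≤ s₂ := by
    have e : Λ / β * (β * b) = Λ * b := by field_simp
    rw [e]; exact hlen
  have key := hlaw A a R s₁ s₂ (β * b) hRR₁ hR1 hT₀ hT₀1 hlen' hshell hcl
  -- ### the run's energy is at most the shell energy, which the E-TAIL bounds
  have hmaps : ∀ x ∈ HoopCore.solidCyl s₁ s₂ (β * b),
      A x + a ∈ closedBall (0 : EuclideanSpace ℝ (Fin 3)) (2 * R) \ ball (0 : EuclideanSpace ℝ (Fin 3)) R := fun x hx => by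
    obtain ⟨h1, h2⟩ := hshell x hx
    exact ⟨mem_closedBall_zero_iff.2 h2, fun h => not_lt.2 h1 (mem_ball_zero_iff.1 h)⟩
  have hSb : Bornology.IsBounded (closedBall (0 : EuclideanSpace ℝ (Fin 3)) (2 * R) \ ball (0 : EuclideanSpace ℝ (Fin 3)) R) :=
    isBounded_closedBall.subset fun _ hx => hx.1
  have h1 := HoopCore.setIntegral_frobeniusNormSq_rigid_le_of_mapsTo hV1 A a hSb hmaps
  have h2 := HoopCore.setIntegral_frobeniusNormSq_le_of_lintegral hV1 (measurableSet_closedBall.diff measurableSet_ball) hSb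
    (by positivity : (0 : ℝ) ≤ ε₀ * Λ / 6 * R ^ (1 - ρ)) (hR₂ R hRR₂)
  -- ### the contradiction `ε₀ΛR^{1−ρ} ≤ ½ε₀ΛR^{1−ρ}`
  have hRb : R ^ 2 * b = R ^ (1 - ρ) := by
    rw [hbdef, ← Real.rpow_two, ← Real.rpow_add hR0]
    congr 1
    ring
  have hL : Λ * b ≤ s₂ - s₁ := by linarith
  have c1 : ε₀ * Λ * R ^ (1 - ρ) ≤ ε₀ * R ^ 2 * (s₂ - s₁) := by
    rw [← hRb]
    have := mul_le_mul_of_nonneg_left hL (by positivity : (0 : ℝ) ≤ ε₀ * R ^ 2)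
    linarith
  have hpos : 0 < ε₀ * Λ * R ^ (1 - ρ) := by positivity
  have hchain : ε₀ * Λ * R ^ (1 - ρ) ≤ 3 * (ε₀ * Λ / 6 * R ^ (1 - ρ)) := c1.trans (key.trans (h1.trans h2))
  exact False.elim (by linarith)

/-! ## §3 Alt 8″: slow ∧ Bernoulli-high runs inside a quiet wall are pressure-ridge runs -/

/-- **alt 8″ ⇒ ridge, run by run** (`ρ > −1`): the four clauses of `HasStraightSlowHighRunsBare` (slow `‖W‖ ≤ λR`, Bernoulli-high `ℋ ≥ h`,
wall pressure `⟨P⟩_θ ≤ h + ηR²`, shell `‖y‖ ≥ R`) give the ridge clause with `μ = ½γ(1−γ) − ½λ² − η` (`ℋ = ½‖W‖² + P − ½γ(1−γ)‖y‖²` at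
centre `0`; `μ > 0` is forced by the face's constraint). [nsreg-p2 g41 ROUND-51 §2, `Sketch51`/`TJbare_Q` sanity examples] -/
theorem hasStraightRidgeRuns_of_bare {ρ : ℝ} (hρ : -1 < ρ) {V : EuclideanSpace ℝ (Fin 3) → EuclideanSpace ℝ (Fin 3)}
    (h : HasStraightSlowHighRunsBare ρ V) : HasStraightRidgeRuns ρ V := by
  intro P' hP
  obtain ⟨Λ, β, lam, η, ν, hΛ, hβ, hlam, hη, hν, hc, hrun⟩ := h P' hP
  have h2ρ : 0 < 2 + ρ := by linarith
  have hγ0 : 0 ≤ 1 / (2 + ρ) := by positivity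
  have hγ1 : 1 / (2 + ρ) ≤ 1 := by rw [div_le_one h2ρ]; linarith
  have hγγ : 0 ≤ (1 / (2 + ρ)) * (1 - 1 / (2 + ρ)) := mul_nonneg hγ0 (by linarith)
  have hμ : 0 < (1 / (2 + ρ)) * (1 - 1 / (2 + ρ)) / 2 - lam ^ 2 / 2 - η := by
    have h0 : 0 ≤ β * (8 * ν ^ 2 + 14 * (1 / (2 + ρ)) * ν) := by positivity
    exact (mul_pos_iff_of_pos_left hΛ).1 (lt_of_le_of_lt h0 hc)
  refine ⟨Λ, β, _, ν, hΛ, hβ, hμ, hν, hc, fun R₀ => ?_⟩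
  obtain ⟨A, a, R, s₁, s₂, hh, hR₀R, hR1, hlen, hshell, hax⟩ := hrun R₀
  refine ⟨A, a, R, s₁, s₂, hR₀R, hR1, hlen, hshell, fun σ hσ => ⟨?_, (hax σ hσ).2.2.2⟩⟩
  obtain ⟨hW, hB, hPavg, -⟩ := hax σ hσ
  have hR0 : 0 ≤ R := by linarith
  have hb0 : 0 ≤ β * R ^ (-(1 + ρ)) := mul_nonneg hβ.le (Real.rpow_nonneg hR0 _)
  have hy : R ≤ ‖A (σ • eZ) + a‖ := (hshell _ (HoopCore.smul_eZ_mem_solidCyl hσ hb0)).1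
  simp only [selfSimilarTransport_apply, sub_zero] at hW
  simp only [selfSimilarBernoulli_apply, sub_zero] at hB
  have h1 : ‖(1 / (2 + ρ)) • (A (σ • eZ) + a) + V (A (σ • eZ) + a)‖ ^ 2 ≤ (lam * R) ^ 2 :=
    pow_le_pow_left₀ (norm_nonneg _) hW 2
  have h2 : R ^ 2 ≤ ‖A (σ • eZ) + a‖ ^ 2 := pow_le_pow_left₀ hR0 hy 2
  nlinarith [mul_le_mul_of_nonneg_left h2 hγγ]

/-- **K-TJ‴ MEMBER (alt 8″)**: in the power-gauge class at `0 < ρ ≤ ½`, the collapse profile of a backward self-similar class member whose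
profile `V` is `C²` and carries, cofinally, STRAIGHT SLOW ∧ BERNOULLI-HIGH RUNS OF LENGTH `≥ Λ·b` INSIDE A QUIET WALL OF RADIUS `β·b`
(`HasStraightSlowHighRunsBare ρ V`: no budget constant, no cap clause, no interior clause) is trivial: `u = 0` a.e.  Binders: exactly
`StraightSlowHighRunsBareMember` (`r51/TJbare_Q.lean` l.103), face BY NAME; = the ridge member after `hasStraightRidgeRuns_of_bare`.
[nsreg-p2 g41 ROUND-51 §2; ns-idea-11 HOOP-NOTE §10] -/
theorem Loc.selfSimilar_ae_eq_zero_of_straightSlowHighRunsBareC2_profile {ρ : ℝ} (hρ : 0 < ρ) (hρ1 : ρ ≤ 1 / 2)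
    {u : ℝ → EuclideanSpace ℝ (Fin 3) → EuclideanSpace ℝ (Fin 3)} {p : ℝ → EuclideanSpace ℝ (Fin 3) → ℝ}
    {H : ℝ → EuclideanSpace ℝ (Fin 3) → EuclideanSpace ℝ (Fin 3) →L[ℝ] EuclideanSpace ℝ (Fin 3)} {c : ℝ≥0}
    (hsw : IsSuitableWeakSolutionOn (slab (EuclideanSpace ℝ (Fin 3)) (Iio 0) isOpen_Iio) 0 0 u p)
    (hH : HasWeakSpatialGradientOn (slab (EuclideanSpace ℝ (Fin 3)) (Iio 0) isOpen_Iio) u H)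
    (hgauge : ∀ a : ℝ, 0 < a →
      ENNReal.ofReal (a ^ (2 * ρ)) * cknA a (0 : ℝ × EuclideanSpace ℝ (Fin 3)) u +
          ENNReal.ofReal (a ^ ρ) * cknE a (0 : ℝ × EuclideanSpace ℝ (Fin 3)) H +
        ENNReal.ofReal (a ^ (2 * ρ)) * cknD a (0 : ℝ × EuclideanSpace ℝ (Fin 3)) p ≤ (c : ℝ≥0∞))
    {V : EuclideanSpace ℝ (Fin 3) → EuclideanSpace ℝ (Fin 3)} {P : EuclideanSpace ℝ (Fin 3) → ℝ}
    (hu : ∀ τ : ℝ, τ < 0 → u τ = selfSimilarCollapse (1 / (2 + ρ)) 0 V τ)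
    (hp : ∀ τ : ℝ, τ < 0 → p τ = selfSimilarCollapsePressure (1 / (2 + ρ)) 0 P τ)
    (hV : ContDiff ℝ 2 V)
    (hQ : HasStraightSlowHighRunsBare ρ V) :
    uncurry u =ᵐ[volume.restrict (Iio (0 : ℝ) ×ˢ (univ : Set (EuclideanSpace ℝ (Fin 3))))] 0 :=
  Loc.selfSimilar_ae_eq_zero_of_straightRidgeRunsC2_profile hρ hρ1 hsw hH hgauge hu hp hV
    (hasStraightRidgeRuns_of_bare (by linarith) hQ)

end Summit.NavierStokesRegularity.NavierStokesRegularity.Theorems.PowerGaugeEulerLiouville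

end
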